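import Mathlib

/-!
# Pao's Euclidean reduction of arc weights — the parity invariant

Solo programme `solo-SmoothPoincare4-informed`, §11.6 THEOREM 11.6, STEP 1 (referee flag R11l).

A smooth circle action on a closed 4-manifold whose singular set maps to a *weighted circle with
two fixed points* in the orbit space carries two coprime arc weights `(m, n)` (Fintushel 1978 §3;
Pao 1978 §2).  Pao's replacement (Pao 1978, Prop. 2: reglue the invariant tube `D² × S²` of the
sphere `E_n ∪ F` by an even-degree loop in `SO(3)`, which is isotopic to the identity) produces,
on the *same* manifold, an action with weights `(m, n')` for any `n' ≡ ± n (mod 2m)`; together with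
the symmetry `(m, n) ↔ (n, m)` this runs a Euclidean algorithm ending at `(1, 1)` (two fixed points,
no exceptional orbits) or `(1, 0)` (a fixed 2-sphere).  This file isolates the elementary
combinatorics used in THEOREM 11.6 (all statements are about the Boolean move predicate `paoMove`
and its reflexive–transitive closure; no proposition-valued definitions are introduced):

* `paoMove` — one Pao move on weight pairs (swap, or `2m ∣ n' - n`, or `2m ∣ n' + n`);
* `paritySum_eq_of_reachable` — the number of odd weights is invariant under Pao moves;
* `gcd_eq_of_reachable` — the gcd (hence coprimality) is invariant;
* `exists_terminal` — from coprime `(m, n)` with `0 < m` one reaches `(1, e)` with `e ≤ 1`;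
* `terminal_eq` — the endpoint is determined by parity: `1 + e = m % 2 + n % 2`, so the endpoint
  is `(1, 1)` iff both weights are odd and `(1, 0)` iff one weight is even
  (`reachable_one_one_iff`, `reachable_one_zero_iff`, `yoshikawa_weights`).

Application (THEOREM 11.6): the double branched cover of a Yoshikawa pair carries weights `(a, n)`
with `a ∈ {3, 5}` odd, so its reduced action has two isolated fixed points iff `n` is odd.
No geometry is formalised here; the file is the bookkeeping certificate for STEP 1.
-/

namespace Summit.SmoothPoincare4.SmoothPoincare4.Theorems.PaoReduction

/-- One Pao move on a pair of arc weights `p = (m, n)`, as a Boolean predicate on `(p, q)`: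
`q` is the swap `(n, m)`, or `q = (m, n')` with `2m ∣ n' - n` (shift) or `2m ∣ n' + n` (reflect). -/
def paoMove (p q : ℕ × ℕ) : Bool :=
  decide (q = (p.2, p.1) ∨
    (q.1 = p.1 ∧ ((2 * (p.1 : ℤ) ∣ (q.2 : ℤ) - p.2) ∨ (2 * (p.1 : ℤ) ∣ (q.2 : ℤ) + p.2))))

/-- Reachability by finitely many Pao moves (reflexive–transitive closure of `paoMove`). -/
local notation:50 p " ⟶* " q => Relation.ReflTransGen (fun a b : ℕ × ℕ => paoMove a b = true) p q

/-- Unfolding of the Boolean move predicate. -/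
theorem paoMove_iff (p q : ℕ × ℕ) : paoMove p q = true ↔
    (q = (p.2, p.1) ∨
      (q.1 = p.1 ∧ ((2 * (p.1 : ℤ) ∣ (q.2 : ℤ) - p.2) ∨ (2 * (p.1 : ℤ) ∣ (q.2 : ℤ) + p.2)))) := by
  simp [paoMove]

/-- The swap is a Pao move. -/
theorem paoMove_swap (m n : ℕ) : paoMove (m, n) (n, m) = true :=
  (paoMove_iff _ _).2 (Or.inl rfl)

/-- A shift `n ↦ n'` with `2m ∣ n' - n` is a Pao move. -/
theorem paoMove_shift {m n n' : ℕ} (h : 2 * (m : ℤ) ∣ (n' : ℤ) - n) :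
    paoMove (m, n) (m, n') = true :=
  (paoMove_iff _ _).2 (Or.inr ⟨rfl, Or.inl h⟩)

/-- A reflection `n ↦ n'` with `2m ∣ n' + n` is a Pao move. -/
theorem paoMove_reflect {m n n' : ℕ} (h : 2 * (m : ℤ) ∣ (n' : ℤ) + n) :
    paoMove (m, n) (m, n') = true :=
  (paoMove_iff _ _).2 (Or.inr ⟨rfl, Or.inr h⟩)

/-- The number of odd weights, `m % 2 + n % 2`. -/
def paritySum (p : ℕ × ℕ) : ℕ := p.1 % 2 + p.2 % 2

/-- A single Pao move preserves the number of odd weights. -/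
theorem paritySum_eq_of_paoMove {p q : ℕ × ℕ} (h : paoMove p q = true) :
    paritySum p = paritySum q := by
  obtain ⟨m, n⟩ := p
  obtain ⟨m', n'⟩ := q
  rcases (paoMove_iff _ _).1 h with h | ⟨h1, h2 | h2⟩
  · simp only [Prod.mk.injEq] at h
    obtain ⟨rfl, rfl⟩ := h
    simp [paritySum, Nat.add_comm]
  · simp only at h1 h2
    have h2' : (2 : ℤ) ∣ (n' : ℤ) - n := (dvd_mul_right 2 _).trans h2
    simp only [paritySum]
    omega
  · simp only at h1 h2
    have h2' : (2 : ℤ) ∣ (n' : ℤ) + n := (dvd_mul_right 2 _).trans h2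
    simp only [paritySum]
    omega

/-- Pao moves preserve the number of odd weights. -/
theorem paritySum_eq_of_reachable {p q : ℕ × ℕ} (h : p ⟶* q) :
    paritySum p = paritySum q := by
  induction h with
  | refl => rfl
  | tail _ hs ih => exact ih.trans (paritySum_eq_of_paoMove hs)

/-- A single Pao move preserves the gcd of the two weights. -/
theorem gcd_eq_of_paoMove {p q : ℕ × ℕ} (h : paoMove p q = true) :
    Nat.gcd p.1 p.2 = Nat.gcd q.1 q.2 := by
  obtain ⟨m, n⟩ := p
  obtain ⟨m', n'⟩ := q
  rcases (paoMove_iff _ _).1 h with h | ⟨h1, h2 | h2⟩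
  · simp only [Prod.mk.injEq] at h
    obtain ⟨rfl, rfl⟩ := h
    simp [Nat.gcd_comm]
  · simp only at h1 h2 ⊢
    rw [h1]
    obtain ⟨t, ht⟩ := h2
    have key : Int.gcd (m : ℤ) (n' : ℤ) = Int.gcd (m : ℤ) (n : ℤ) := by
      rw [show (n' : ℤ) = n + (2 * t) * (m : ℤ) by linarith]
      exact Int.gcd_add_mul_right_right _ _ _
    simpa [Int.gcd_natCast_natCast] using key.symm
  · simp only at h1 h2 ⊢
    rw [h1]
    obtain ⟨t, ht⟩ := h2
    have key : Int.gcd (m : ℤ) (n' : ℤ) = Int.gcd (m : ℤ) (n : ℤ) := by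
      rw [show (n' : ℤ) = -(n : ℤ) + (2 * t) * (m : ℤ) by linarith,
        Int.gcd_add_mul_right_right, Int.gcd_neg]
    simpa [Int.gcd_natCast_natCast] using key.symm

/-- Pao moves preserve the gcd of the two weights (so coprimality is invariant). -/
theorem gcd_eq_of_reachable {p q : ℕ × ℕ} (h : p ⟶* q) :
    Nat.gcd p.1 p.2 = Nat.gcd q.1 q.2 := by
  induction h with
  | refl => rfl
  | tail _ hs ih => exact ih.trans (gcd_eq_of_paoMove hs)

/-- One round of the Euclidean algorithm: from `(m, n)` with `0 < m` one reaches `(m, r)` with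
`r ≤ m` (reduce `n` modulo `2m` into `[0, 2m)`, then reflect into `[0, m]` if necessary). -/
theorem reachable_reduce (m n : ℕ) (hm : 0 < m) :
    ∃ r, r ≤ m ∧ ((m, n) ⟶* (m, r)) := by
  have hlt : n % (2 * m) < 2 * m := Nat.mod_lt _ (by omega)
  have hshift : (m, n) ⟶* (m, n % (2 * m)) := by
    refine Relation.ReflTransGen.single (paoMove_shift ?_)
    have hdiv : (2 * m : ℕ) ∣ n - n % (2 * m) := Nat.dvd_sub_mod n
    have hle : n % (2 * m) ≤ n := Nat.mod_le _ _
    have : (2 * (m : ℤ)) ∣ (n : ℤ) - (n % (2 * m) : ℕ) := by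
      have := Int.natCast_dvd_natCast.2 hdiv
      push_cast [Nat.cast_sub hle] at this
      exact this
    rw [← Int.dvd_neg] at this
    simpa using this
  by_cases h : n % (2 * m) ≤ m
  · exact ⟨n % (2 * m), h, hshift⟩
  · refine ⟨2 * m - n % (2 * m), by omega, hshift.tail (paoMove_reflect ?_)⟩
    have : ((2 * m - n % (2 * m) : ℕ) : ℤ) + (n % (2 * m) : ℕ) = 2 * (m : ℤ) * 1 := by
      push_cast [Nat.cast_sub hlt.le]; ring
    rw [this]
    exact Dvd.intro 1 rfl

/-- Pao's Euclidean algorithm terminates: from coprime weights `(m, n)` with `0 < m` one reaches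
`(1, e)` with `e ≤ 1`. -/
theorem exists_terminal : ∀ (m n : ℕ), 0 < m → Nat.Coprime m n →
    ∃ e, e ≤ 1 ∧ ((m, n) ⟶* (1, e)) := by
  intro m
  induction m using Nat.strong_induction_on with
  | _ m ih =>
    intro n hm hcop
    obtain ⟨r, hr, hreach⟩ := reachable_reduce m n hm
    have hgcd : Nat.gcd m r = 1 := by
      have := gcd_eq_of_reachable hreach
      simpa [hcop.gcd_eq_one] using this.symm
    rcases Nat.lt_or_ge 1 m with hm1 | hm1
    · -- `m ≥ 2`: then `0 < r < m`; swap and recurse on the smaller first weight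
      have hr0 : r ≠ 0 := by
        rintro rfl; simp at hgcd; omega
      have hrm : r ≠ m := by
        rintro rfl; simp at hgcd; omega
      have hrlt : r < m := lt_of_le_of_ne hr hrm
      obtain ⟨e, he, hreach'⟩ :=
        ih r hrlt m (Nat.pos_of_ne_zero hr0) (Nat.coprime_comm.mp hgcd)
      exact ⟨e, he, (hreach.tail (paoMove_swap m r)).trans hreach'⟩
    · -- `m = 1`
      have hm' : m = 1 := by omega
      subst hm'
      exact ⟨r, hr, hreach⟩

/-- The endpoint is determined by the parities: if `(m, n)` reaches `(1, e)` with `e ≤ 1` then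
`1 + e = m % 2 + n % 2`. -/
theorem terminal_eq {m n e : ℕ} (he : e ≤ 1) (h : (m, n) ⟶* (1, e)) :
    1 + e = m % 2 + n % 2 := by
  have := paritySum_eq_of_reachable h
  simp only [paritySum] at this
  interval_cases e <;> omega

/-- Coprime weights with `0 < m` reach `(1, 1)` (two isolated fixed points, no exceptional
orbits) iff both are odd. -/
theorem reachable_one_one_iff {m n : ℕ} (hm : 0 < m) (hcop : Nat.Coprime m n) :
    ((m, n) ⟶* (1, 1)) ↔ (m % 2 = 1 ∧ n % 2 = 1) := by
  constructor
  · intro h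
    have := terminal_eq (le_refl 1) h
    omega
  · rintro ⟨hmo, hno⟩
    obtain ⟨e, he, hreach⟩ := exists_terminal m n hm hcop
    have := terminal_eq he hreach
    interval_cases e
    · omega
    · exact hreach

/-- Coprime weights with `0 < m` reach `(1, 0)` (fixed point set a 2-sphere) iff one of them is
even. -/
theorem reachable_one_zero_iff {m n : ℕ} (hm : 0 < m) (hcop : Nat.Coprime m n) :
    ((m, n) ⟶* (1, 0)) ↔ (m % 2 = 0 ∨ n % 2 = 0) := by
  constructor
  · intro h
    have := terminal_eq (Nat.zero_le 1) h
    omega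
  · intro hpar
    obtain ⟨e, he, hreach⟩ := exists_terminal m n hm hcop
    have hsum := terminal_eq he hreach
    have hodd : ¬ (m % 2 = 0 ∧ n % 2 = 0) := by
      rintro ⟨h1, h2⟩
      have h21 : 2 ∣ Nat.gcd m n :=
        Nat.dvd_gcd (Nat.dvd_of_mod_eq_zero h1) (Nat.dvd_of_mod_eq_zero h2)
      rw [hcop.gcd_eq_one] at h21
      omega
    interval_cases e
    · exact hreach
    · omega

/-- The case used in THEOREM 11.6: weights `(a, n)` with `a` odd (there `a ∈ {3, 5}`) and
`gcd(a, n) = 1` reach `(1, 1)` iff `n` is odd, and `(1, 0)` iff `n` is even. -/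
theorem yoshikawa_weights {a n : ℕ} (ha : a % 2 = 1) (hcop : Nat.Coprime a n) :
    (((a, n) ⟶* (1, 1)) ↔ n % 2 = 1) ∧ (((a, n) ⟶* (1, 0)) ↔ n % 2 = 0) := by
  have ha0 : 0 < a := by omega
  refine ⟨?_, ?_⟩
  · rw [reachable_one_one_iff ha0 hcop]; omega
  · rw [reachable_one_zero_iff ha0 hcop]; omega

end Summit.SmoothPoincare4.SmoothPoincare4.Theorems.PaoReduction
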